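import Summits.ABC.StewartYu.PadicG3TwoBasisStep
import Summits.ABC.StewartYu.PadicG3TwoMainChain
import Summits.ABC.StewartYu.PadicG3TwoFrameFromMain
import Summits.ABC.StewartYu.KummerBasisChange
import HarnessLib

/-!
# Cell abc-stewartyu, Gen-3 frame at `p = 2` (crux `Y07Two`, stmt-ABC-19659), assembly: the frame REDUCED TO THE
# RECORD — `FrameTwoLast C d` (and the registered stub's text) from ONE bundle of numeric obligations per datum

`Summits/ABC/StewartYu/PadicG3TwoFrameNumerics.lean` — cell `abc-stewartyu` (HOME `run/shared/lean/pub/abc-stewartyu/`),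
route `PadicPrimesKummerThird`, seat p5 (g3).  One `Prop`-structure (`FrameNumericsTwo`, the record's complete
obligation list for the analytic frame on the pre-scaled Fel'dman basis) and theorems; no named fact.

WHAT IS COMPOSED.  For the datum `S = ofData d α b …` of `GenThreeFramePivotTwo.FrameTwoLast` and a schedule
`σ : S.G3TwoSched` with Fel'dman parameters `H, L₀`:
* level `0`: `siegelTwo_feldman_scaled` (p5, on p3-g5's `exists_g3_slab_siegel`) — Siegel count, box/coefficient
  slots, `2`-adic weight line, pointwise Hasse sizes at the points `3^{I*}x`, `Amax`, `P`;
* inner chains: `kchainTwo_of_kfinal` (p5) from `KFinalTwo σ I`, `I ≤ I*`;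
* third steps: `thirdStepTwo_of` (p5) from `ThirdFinalTwo σ I` and the basis step `basisStepTwo_feld` (p5) from the
  Hasse-size lines at level `I + 1`, `I < I*`, with the `3`-Kummer condition of the datum
  (`KummerBasisChange.kummerNat_of_kummerInt`);
* the END: p3-g5's `frameTwoLast_of_mainTwo` / `stub_frameTwoLast_of_mainTwo`.
Result: **`frameTwoLast_of_numerics`** and **`stub_frameTwoLast_of_numerics`** — the registered stub
`stub_frameTwoLast` of crux stmt-ABC-19659 follows from: an admissible constant function, and for every pivot-last
datum under the negated bound, numbers `σ, H, L₀, S₀, X` with `FrameNumericsTwo σ H L₀`, the slab smallness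
`‖Λ₀‖ ≤ 2^{−(m+3)}` (`PadicG3TwoNegBound`), the END ranges, and `RecordTwo` — all of them statements about the
PARAMETER LEDGER (`PadicG3Par`, p = 2 column; lp-1 / p1), no analysis left.

WHAT THIS IS NOT: no numbers are chosen here; no crux moves.

References: K. Yu, Acta Math. 211 (2013), §3.1, §5–§6; Yu. V. Nesterenko, LNM 1819 (2003), §3.5, §4, §5.1.
-/

noncomputable section

open Finset Polynomial
open Literature.NumberTheory.Transcendental
open Literature.NumberTheory.Transcendental (FeldmanDelta.den)
open Literature.NumberTheory.Transcendental.FeldmanDelta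
open Literature.NumberTheory.Transcendental.CW77.Setup (Tau tauNorm)

namespace Summit.ABC.StewartYu.TwoSetup

open Summit.ABC.StewartYu.FeldmanBasis Summit.ABC.StewartYu.G3Boxes

variable {S : TwoSetup} (σ : S.G3TwoSched)

/-- **THE RECORD'S COMPLETE OBLIGATION LIST FOR THE ANALYTIC FRAME** on the pre-scaled Fel'dman basis with
parameters `H ≥ 1`, `L₀`: the level-`0` Siegel lines, the `Y₀`-weight denominators `ν(H)^t` and Hasse sizes at
the points `3^{I*−I}x` for every level, the inner-chain numerics `KFinalTwo σ I` (`I ≤ I*`) and the third-step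
numerics `ThirdFinalTwo σ I` (`I < I*`). [cite: Yu2013, §3.1 (3.1)–(3.9) and (3.22); shape only] -/
structure FrameNumericsTwo (H L₀ : ℕ) : Prop where
  /-- the Fel'dman block is nonempty -/
  one_le_H : 1 ≤ H
  /-- at least one order at level `0` -/
  T0_pos : 1 ≤ σ.T0 0
  /-- Siegel's count on the slab class: `2·2^m·#E₀ ≤ #box` -/
  count : 2 * 2 ^ σ.m * ((2 * σ.N0 0 + 1) * σ.T0 0 ^ (S.d + 1)) ≤
    (L₀ + 1) * ((∏ j, (2 * σ.Dbox 0 j + 1)) * (2 * σ.Dθ 0 + 1))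
  /-- the family-size slot at level `0` -/
  cardB0 : (famBox L₀ (σ.Dbox 0) (σ.Dθ 0)).card ≤ σ.cardB 0
  /-- the `Y₀`-degree slot -/
  L_le : L₀ ≤ σ.D₀
  /-- the directional slot at level `0` -/
  Xb0 : ∀ i ∈ famBox L₀ (σ.Dbox 0) (σ.Dθ 0), ∀ j, |S.dirScalar i.2.1 i.2.2 j| ≤ σ.Xb 0
  /-- the `2`-adic weight line at level `0` (radius `4·2^m`) -/
  Bw0 : ∀ ℓ, ℓ ≤ L₀ → ‖((den ℓ H : ℚ_[2]))⁻¹‖ * (4 * (2 : ℝ) ^ σ.m) ^ ℓ ≤ σ.Bw 0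
  /-- the `Y₀`-weight denominators are `ν(H)^t` at every level -/
  den₀_eq : ∀ (I : ℕ) (x : ℤ) (τ : Tau S.d), σ.den₀ I x τ = Nat.lcmUpto H ^ τ.1
  /-- Fel'dman's Hasse sizes at the points `3^{I*−I}x`, every level `I ≤ I*` -/
  M₀_ge : ∀ I, I ≤ σ.Istar → ∀ (x : ℤ) (τ : Tau S.d), ∀ ℓ, ℓ ≤ L₀ →
    (3 : ℝ) ^ ((σ.Istar - I) * τ.1) * ((Nat.lcmUpto H : ℝ) ^ τ.1 *
      (Real.exp (H / Real.exp 1) * (Real.exp 1 * (1 + (3 : ℝ) ^ (σ.Istar - I) * |(x : ℝ)| / H)) ^ ℓ)) ≤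
      σ.M₀ I x τ
  /-- the level-`0` Siegel size `Amax` and the coefficient slot `P` -/
  level0_size : ∃ (M₀E : ℤ) (Amax : ℝ), (∀ e ∈ eqSet S.d (σ.N0 0) (σ.T0 0), σ.M₀ 0 e.1 e.2 ≤ M₀E) ∧
    1 ≤ Amax ∧ (∀ e ∈ eqSet S.d (σ.N0 0) (σ.T0 0), (M₀E : ℝ) * (σ.Xb 0 : ℝ) ^ (∑ j, e.2.2 j) *
      ((MonomialDen.monDen S.toQ.all (S.boxExp (σ.Dbox 0) (σ.Dθ 0) e.1) : ℝ)) ^ 2 ≤ Amax) ∧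
    ⌈((famBox L₀ (σ.Dbox 0) (σ.Dθ 0)).card : ℝ) * Amax⌉ ≤ σ.P
  /-- the inner-chain numerics of every level -/
  kfinal : ∀ I, I ≤ σ.Istar → KFinalTwo σ I
  /-- the third-step numerics of every level below the last -/
  third : ∀ I, I < σ.Istar → ThirdFinalTwo σ I

/-- **THE LEVELS FROM THE NUMBERS**: `FrameNumericsTwo` + the slab smallness `‖Λ₀‖ ≤ 2^{−(m+3)}` + the `3`-Kummer
condition on `(α, θ)` give the three inputs of `mainTwo` for the shape `ShFeld I* H L₀`.
[cite: Yu2013, §5 (5.19)–(5.20); shape only] -/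
theorem levels_of_numerics {H L₀ : ℕ} (hnum : FrameNumericsTwo σ H L₀)
    (hΛ : ‖S.Λ₀‖ ≤ ((2 : ℝ) ^ (σ.m + 3))⁻¹)
    (hK : ∀ κ : Fin (S.d + 1) → ℕ, (∃ j, ¬ 3 ∣ κ j) → ∀ γ : ℚ, ∏ j, S.toQ.all j ^ κ j ≠ γ ^ 3) :
    SiegelTwo σ (ShFeld σ.Istar H L₀) ∧ (∀ I, I ≤ σ.Istar → KChainTwo σ (ShFeld σ.Istar H L₀) I) ∧
      (∀ I, I < σ.Istar → ThirdStepTwo σ (ShFeld σ.Istar H L₀) I) := by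
  obtain ⟨M₀E, Amax, hM₀E, hAmax, hA, hP⟩ := hnum.level0_size
  refine ⟨?_, fun I hI => kchainTwo_of_kfinal σ _ (hnum.kfinal I hI), fun I hI => ?_⟩
  · refine siegelTwo_feldman_scaled σ H L₀ hnum.one_le_H hΛ hnum.T0_pos hnum.count hnum.cardB0 hnum.L_le
      hnum.Xb0 hnum.Bw0 (hnum.den₀_eq 0) ?_ hM₀E hAmax hA hP
    intro x τ ℓ hℓ
    have h := hnum.M₀_ge 0 (Nat.zero_le _) x τ ℓ hℓ
    simpa only [Nat.sub_zero] using h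
  · exact thirdStepTwo_of σ _ (hnum.third I hI)
      (basisStepTwo_feld σ hnum.one_le_H hI (hnum.den₀_eq (I + 1)) (hnum.M₀_ge (I + 1) hI)) hK

/-- **`FrameTwoLast C d` FROM THE RECORD**: for every pivot-last datum under the negated bound, numbers
`σ, H, L₀, S₀, X` with the frame numerics, the slab smallness, the END ranges and `RecordTwo` give the frame.
[cite: Yu2013, §5–§6; shape only] -/
theorem frameTwoLast_of_numerics {C : ℕ → ℝ} {d : ℕ}
    (h : ∀ (α : Fin (d + 1) → ℚ) (b : Fin (d + 1) → ℤ) (V : Fin (d + 1) → ℝ) (Vmax W : ℝ)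
      (hα : ∀ j, 3 ≤ padicValRat 2 (α j - 1)),
      (∀ μ : Fin (d + 1) → ℤ, ∏ j, α j ^ μ j = 1 → μ = 0) →
      (∀ κ : Fin (d + 1) → ℤ, (∃ γ : ℚ, ∏ j, α j ^ κ j = γ ^ 3) → ∀ j, (3 : ℤ) ∣ κ j) →
      (∀ j, Height.logHeight₁ (α j) ≤ V j) → (∀ j, 1 ≤ V j) → (∀ j, V j ≤ Vmax) →
      ∀ (hb : b (Fin.last d) ≠ 0)
        (hmin : ∀ j, b j ≠ 0 → padicValInt 2 (b (Fin.last d)) ≤ padicValInt 2 (b j)),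
      (∀ j, Real.log (max 3 (|b j| : ℝ)) ≤ W) → 1 ≤ W →
      ¬ (padicValRat 2 (∏ j, α j ^ b j - 1) : ℝ) ≤ C (d + 1) * (∏ j, V j) * (W + Real.log (2 * Vmax)) →
      ∃ (σ : (ofData d α b hα hb hmin).G3TwoSched) (H L₀ S₀ X : ℕ),
        FrameNumericsTwo σ H L₀ ∧ ‖(ofData d α b hα hb hmin).Λ₀‖ ≤ ((2 : ℝ) ^ (σ.m + 3))⁻¹ ∧
        (d + 1 + 1) * X ≤ σ.Nfin σ.Istar ∧ (d + 1 + 1) * S₀ < σ.Tfin σ.Istar ∧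
        GenThreeFrameSpecTwo.RecordTwo C (d + 1) V Vmax W σ.D₀ S₀ X
          (Fin.snoc (σ.Dbox σ.Istar) (σ.Dθ σ.Istar))) :
    GenThreeFramePivotTwo.FrameTwoLast C d := by
  refine frameTwoLast_of_mainTwo fun α b V Vmax W hα hind hKZ hV hV1 hVmax hb hmin hW hW1 hneg => ?_
  obtain ⟨σ, H, L₀, S₀, X, hnum, hΛ, hX, hT, hrec⟩ :=
    h α b V Vmax W hα hind hKZ hV hV1 hVmax hb hmin hW hW1 hneg
  have hK : ∀ κ : Fin (d + 1) → ℕ, (∃ j, ¬ 3 ∣ κ j) → ∀ γ : ℚ,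
      ∏ j, (ofData d α b hα hb hmin).toQ.all j ^ κ j ≠ γ ^ 3 := by
    rw [ofData_all]
    exact KummerBasisChange.kummerNat_of_kummerInt 3 α hKZ
  obtain ⟨hS, hk, hth⟩ := levels_of_numerics σ hnum hΛ hK
  exact ⟨_, σ, ShFeld σ.Istar H L₀, S₀, X, hS, hk, hth, hX, hT, hrec⟩

/-- **THE REGISTERED STUB'S TEXT FROM THE RECORD** (`stub_frameTwoLast` of crux stmt-ABC-19659): an admissible
constant function `C ≤ c₁ⁿ`, `4 ≤ C 1`, and for every `d ≥ 1` and every pivot-last datum under the negated bound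
the frame numerics + slab smallness + END ranges + `RecordTwo`. [cite: Yu2007, Main Thm (K = ℚ, ℘ = 2); shape only] -/
theorem stub_frameTwoLast_of_numerics {C : ℕ → ℝ} {c₁ : ℝ} (hc₁ : 1 ≤ c₁)
    (hC : ∀ m, 0 ≤ C m ∧ C m ≤ c₁ ^ m) (hC1 : 4 ≤ C 1)
    (h : Nesterenko2003_prop51 → ∀ d, 1 ≤ d →
      ∀ (α : Fin (d + 1) → ℚ) (b : Fin (d + 1) → ℤ) (V : Fin (d + 1) → ℝ) (Vmax W : ℝ)
      (hα : ∀ j, 3 ≤ padicValRat 2 (α j - 1)),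
      (∀ μ : Fin (d + 1) → ℤ, ∏ j, α j ^ μ j = 1 → μ = 0) →
      (∀ κ : Fin (d + 1) → ℤ, (∃ γ : ℚ, ∏ j, α j ^ κ j = γ ^ 3) → ∀ j, (3 : ℤ) ∣ κ j) →
      (∀ j, Height.logHeight₁ (α j) ≤ V j) → (∀ j, 1 ≤ V j) → (∀ j, V j ≤ Vmax) →
      ∀ (hb : b (Fin.last d) ≠ 0)
        (hmin : ∀ j, b j ≠ 0 → padicValInt 2 (b (Fin.last d)) ≤ padicValInt 2 (b j)),
      (∀ j, Real.log (max 3 (|b j| : ℝ)) ≤ W) → 1 ≤ W →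
      ¬ (padicValRat 2 (∏ j, α j ^ b j - 1) : ℝ) ≤ C (d + 1) * (∏ j, V j) * (W + Real.log (2 * Vmax)) →
      ∃ (σ : (ofData d α b hα hb hmin).G3TwoSched) (H L₀ S₀ X : ℕ),
        FrameNumericsTwo σ H L₀ ∧ ‖(ofData d α b hα hb hmin).Λ₀‖ ≤ ((2 : ℝ) ^ (σ.m + 3))⁻¹ ∧
        (d + 1 + 1) * X ≤ σ.Nfin σ.Istar ∧ (d + 1 + 1) * S₀ < σ.Tfin σ.Istar ∧
        GenThreeFrameSpecTwo.RecordTwo C (d + 1) V Vmax W σ.D₀ S₀ X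
          (Fin.snoc (σ.Dbox σ.Istar) (σ.Dθ σ.Istar))) :
    ∃ (C : ℕ → ℝ) (c₁ : ℝ), 1 ≤ c₁ ∧ (∀ m, 0 ≤ C m ∧ C m ≤ c₁ ^ m) ∧ 4 ≤ C 1 ∧
      (Nesterenko2003_prop51 → ∀ d, 1 ≤ d → GenThreeFramePivotTwo.FrameTwoLast C d) :=
  ⟨C, c₁, hc₁, hC, hC1, fun hZ d hd => frameTwoLast_of_numerics (h hZ d hd)⟩

end Summit.ABC.StewartYu.TwoSetup

end
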